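import Summits.BirchSwinnertonDyer.Rank1Residual.Supersingular.DescentLowerBound
import Summits.BirchSwinnertonDyer.Rank1Residual.Supersingular.RationalLadder
import Summits.BirchSwinnertonDyer.Rank1Residual.Additive.QuadraticTwistBSDComparisonIsogeny
import Summits.BirchSwinnertonDyer.Rank1Residual.Additive.SharpenedStatements
import Summits.BirchSwinnertonDyer.Rank1Residual.X11b.ChaPairsMinimality
import Summits.BirchSwinnertonDyer.BirchSwinnertonDyer.Theorems.Rank1ResidualIntModelReduction
import Literature.NumberTheory.EllipticCurves.AnomalousOfRationalTorsionProofs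
import HarnessLib

/-!
# Route `KatoDescentTamePotSupersingular` (rung K8-t′ = KT, cell `bsd-potss`), child crux `TameLowerIntrinsicNonCM`
# (item stmt-BirchSwinnertonDyer-19618), registered stub `stub_intr_residualNonCM` — its REDUCIBLE disjunct
# (X3 ∩ (t′): `E[p]` reducible, so `ρ̄_{E,p}` is not onto and the `3`-adic tower is not onto): the per-class
# `p`-ISOGENY-DESCENT ROAD in record SHAPE, at ANY odd prime `p` (seat `bsd-potss-kt-pdesc`, ACCEL row (4) of
# planner bsd-potss-plan g14; a `--supports stmt-BirchSwinnertonDyer-19618` helper file; closes NOTHING class-wide)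

PARTITION (D-0054, cell bsd-potss): EXCLUDED-DOMAIN non-CM additive `p` · B4 (t′) (`Addv W p ∧ SubTprime W p`,
`e ∈ {3,4,6}`), `r_an = 0`, INTRINSIC classes (every globally minimal member has `p ∣ #Ш_an`) × {`E[p]`
REDUCIBLE} — the reducible rows of the registered stub `Sig.stub_intr_residualNonCM` of the birth skeleton v4
(`Cruxes/TameLowerIntrinsicNonCM`, planner g15, sha be23a54d…): `p = 3`: 27 classes, `p = 5`: 3 classes,
`p ≥ 7`: none below `5·10⁵` (b2b O5 class-closure census). Class-wide the stub is Kato's Conj. 12.10 (lower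
half) at an additive potentially supersingular prime off every certificate road: OPEN. Nothing here proves it.

WHAT THIS FILE DOES (the `p`-general twin of seat k9-desc3's `…WildLowerDesc3Shape.lean`, p454413, which is the
`p = 3` wild instance). The tree holds the class-free per-pair consumer
`Supersingular.missingLowerBoundAt_of_casselsTate_of_selmerGroup_ne_bot` (= the route's named road
`Theorems.tameMissingLowerBoundAt_rankZero_of_selmer_ne_bot` of `…TameLowerKimRoad.lean` §3 WITHOUT its two idle
route binders `Addv`/`SubTprime`: rank `0` by GZK, `p ∤ #E(ℚ)_tors`, `Sel^(p)(E/ℚ) ≠ ⊥` ⇒ `Ш[p] ≠ 0` ⇒ `p² ∣ #Ш`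
by Cassels–Tate ⇒ `MissingLowerBoundAt W p` when `ord_p #Ш_an ≤ 2`), the witness form
`missingLowerBoundAt_of_casselsTate_of_pow_dvd` + `dvd_shaOrder_of_exists_torsion` (ONE nonzero `x ∈ Ш(E)` with
`p·x = 0`; NO torsion hypothesis), and Cassels' transport `TwistComparison.missingLowerBoundAt_of_isIsogenous`.
New here, for every odd `p`:

* §1 the CLASS road in the Selmer currency: a globally minimal member `W₀` of analytic rank `0` with
  `p ∤ #W₀(ℚ)_tors`, `ord_p #Ш_an(W₀) ≤ 2`, `Sel^(p)(W₀/ℚ) ≠ ⊥` ⇒ `MissingLowerBoundAt W p` at EVERY globally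
  minimal `W ∼_ℚ W₀`;
* §2 the CLASS road in the Ш-witness currency (`∃ x ∈ Ш(W₀)`, `x ≠ 0`, `p·x = 0`; needed exactly on the classes
  where SOME member has a rational `p`-torsion point: there `p ∣ #Ẽ(𝔽_ℓ)` at every good `ℓ` for EVERY member —
  `a_ℓ` is a class invariant — so §3's point-count criterion cannot certify `p ∤ #W₀(ℚ)_tors` even when it holds);
* §3 the record SHAPES on a literal model `W₀ = ⟨a₁,…,a₆⟩`: global minimality (`hmin`, discharged per record by
  the tree's Kraus criteria), `p ∤ #W₀(ℚ)_tors` DECIDED from one odd good prime `ℓ` with `p ∤ countPoints … ℓ`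
  (Cauchy + `addOrderOf_dvd_reductionPointCount`, Silverman VII.3.1(b)), the DISPLAYED per-pair lines `hr`
  (`r_an = 0`), `hs`/`hv` (`#Ш_an(W₀) = s`, `ord_p s ≤ 2`) and the certificate line (`hSel` or `hwit`) whose
  EVIDENCE is a two-engine `p`-isogeny descent row (kit j257757: engines 2χ `isogchi.gp` / 2cft `isogcft.gp` of
  cell b2b-bsdres-sha-2, unmodified; `dim Ш(W₀)[φ] ≥ 1` for a rational `p`-isogeny `φ` of `W₀`);
* §4 the REDUCIBLE DISJUNCT of the registered stub from ONE certificate per class (`…_of_certificates`): the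
  honest conditional form — restricted to the census the hypothesis is what the records instantiate; class-wide
  it is the stub itself. The stub's certificate-road hypothesis `¬((5 ≤ p ∧ Surj W p) ∨ (p = 3 ∧ tower onto ∧ …))`
  is automatic on a reducible row and is therefore not among the binders.

HONEST LABEL: per class a finite certificate road over four PUBLISHED facts taken by name (Cassels–Tate
`exists_casselsTate_pairing`, Cassels `bsdRHS_eq_of_isIsogenous`, GZK `rank_eq_analyticRank_of_analyticRank_le_one`,
modularity `hasEntireLFunction_rat`); the certificate line is a binder whose evidence lives outside the kernel;
BSD is not proved; the item is NOT closed; nothing is booked here. THEOREMS ONLY (no definition, no named fact,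
no `sorry`). Route-free imports (cell b2b-bsdres files only).

References: [SilvermanAEC2009] VII.3.1(b), VII.3.4, X.4.14; [Cassels1965ArithmeticVIII]; [MilneADT2006] Thm. I.7.3;
[Miller2011LMS] Def. 1.1; [Kato2004Asterisque] Conj. 12.10 (p. 224); [SchaeferStoll2004]; Schaefer, J. Number
Theory 56 (1996) Lemma 3.8 (the engines' local target sizes).
-/

set_option autoImplicit false
-- sibling precedent (`KatoDescentTamePotSupersingularTameLowerKimRoad.lean`): the directory name repeats the summit name
set_option linter.dupNamespace false

noncomputable section

open scoped Classical

namespace Summit.BirchSwinnertonDyer.BirchSwinnertonDyer.Theorems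

open WeierstrassCurve Literature.NumberTheory.EllipticCurves
  Literature.NumberTheory.EllipticCurves.Rank1Residual
  Literature.NumberTheory.EllipticCurves.Rank1Residual.Typed
  Literature.NumberTheory.EllipticCurves.Rank1Residual.X11RankOneCertificates
  Summit.BirchSwinnertonDyer.BirchSwinnertonDyer.Rank1Residual.IntModel
  Summit.BirchSwinnertonDyer.Rank1Residual
  Summit.BirchSwinnertonDyer.Rank1Residual.Additive
  Summit.BirchSwinnertonDyer.Rank1Residual.Supersingular

/-! ## §1 The class road, Selmer currency (any prime `p`) -/

/-- **`MissingLowerBoundAt W p` at EVERY globally minimal member `W` of the `ℚ`-isogeny class of a certified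
member** (class-free, any prime `p`): if `W₀` is globally minimal of analytic rank `0` with `p ∤ #W₀(ℚ)_tors`,
`#Ш_an(W₀) = s`, `ord_p s ≤ 2` and `Sel^(p)(W₀/ℚ) ≠ ⊥`, then the lower half holds at every globally minimal
`W ∼_ℚ W₀`: the cell's `Supersingular.missingLowerBoundAt_of_casselsTate_of_selmerGroup_ne_bot` at `W₀` (rank `0`
by GZK and no rational `p`-torsion make `Sel^(p) ≅ Ш[p]` non-zero ⇒ `p ∣ #Ш` ⇒ `p² ∣ #Ш` by Cassels–Tate), then
Cassels' transport (`TwistComparison.missingLowerBoundAt_of_isIsogenous`: the class defect `ord_p #Ш − ord_p #Ш_an`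
is an isogeny invariant over Cassels `hCassels` + GZK + modularity `hmod`). The `p = 3` instance is k9-desc3's
`K9Desc3.missingLowerBoundAt_three_of_isIsogenous_of_selmerGroup_ne_bot`. Conditional on the four published facts
and the certificate line. [cite: MilneADT2006, Thm. I.7.3] [cite: SilvermanAEC2009, Thm. X.4.14]
[cite: Miller2011LMS, §1 and Def. 1.1] -/
theorem KTPdesc.missingLowerBoundAt_of_isIsogenous_of_selmerGroup_ne_bot
    (hCT : exists_casselsTate_pairing (K := ℚ)) (hCassels : bsdRHS_eq_of_isIsogenous)
    (hGZK : rank_eq_analyticRank_of_analyticRank_le_one) (hmod : hasEntireLFunction_rat)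
    (W₀ : WeierstrassCurve ℚ) [W₀.IsElliptic] [W₀.IsGloballyMinimal] (p : ℕ) [Fact p.Prime]
    (hr : W₀.analyticRank = 0) (htors : ¬ p ∣ W₀.torsionOrder) {s : ℚ} (hs : shaAn W₀ = (s : ℂ))
    (hv : padicValRat p s ≤ 2) (hSel : W₀.selmerGroup (p : ℤ) ≠ ⊥)
    (W : WeierstrassCurve ℚ) [W.IsElliptic] [W.IsGloballyMinimal] (hiso : IsIsogenous W W₀) :
    MissingLowerBoundAt W p := by
  have hr' : W₀.analyticRank ≤ 1 := by rw [hr]; exact zero_le_one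
  exact TwistComparison.missingLowerBoundAt_of_isIsogenous W₀ W p hCassels hGZK hmod hiso.symm_of_charZero hr'
    (Supersingular.missingLowerBoundAt_of_casselsTate_of_selmerGroup_ne_bot W₀ p hCT hGZK hr htors hs hv hSel)

/-! ## §2 The class road, Ш-witness currency (any prime `p`; no torsion hypothesis) -/

/-- **`MissingLowerBoundAt W₀ p` at a pair from ONE element of order `p` in `Ш(W₀)`** (class-free, any prime
`p`): `W₀` of analytic rank `0` (so `Ш(W₀)` finite by GZK), `#Ш_an(W₀) = s` with `ord_p s ≤ 2`, and a nonzero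
`x ∈ Ш(W₀/ℚ)` with `p·x = 0` ⇒ `p ∣ #Ш` (`dvd_shaOrder_of_exists_torsion`) ⇒ `p² ∣ #Ш` by Cassels–Tate squareness
(`missingLowerBoundAt_of_casselsTate_of_pow_dvd`, `k = 1`) ⇒ `ord_p #Ш_an ≤ 2 ≤ ord_p #Ш`. NO hypothesis on
`#W₀(ℚ)_tors`: this is the currency for the classes meeting rational `p`-torsion (the rank-`0` version of the K9
per-pair road `missingLowerBoundAt_of_torsionWitness_of_le_two`, here without the route import).
[cite: SilvermanAEC2009, Thm. X.4.14] [cite: Miller2011LMS, §1 and Def. 1.1] -/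
theorem KTPdesc.missingLowerBoundAt_of_shaWitness (hCT : exists_casselsTate_pairing (K := ℚ))
    (hGZK : rank_eq_analyticRank_of_analyticRank_le_one)
    (W₀ : WeierstrassCurve ℚ) [W₀.IsElliptic] (p : ℕ) [Fact p.Prime] (hr : W₀.analyticRank = 0)
    {s : ℚ} (hs : shaAn W₀ = (s : ℂ)) (hv : padicValRat p s ≤ 2)
    (hwit : ∃ x : W₀.sha, x ≠ 0 ∧ p • x = 0) : MissingLowerBoundAt W₀ p :=
  missingLowerBoundAt_of_casselsTate_of_pow_dvd W₀ p hCT (hGZK W₀ (by rw [hr]; norm_num)).2 hs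
    (k := 1) (by simpa using hv) (by simpa using dvd_shaOrder_of_exists_torsion W₀ p hwit)

/-- **`MissingLowerBoundAt W p` at EVERY globally minimal member of the class of a member carrying a Ш-witness**
(class-free, any prime `p`): §2's pair form at `W₀`, then Cassels' transport
(`TwistComparison.missingLowerBoundAt_of_isIsogenous`). Conditional on Cassels–Tate, Cassels, GZK, modularity
and the witness line. [cite: MilneADT2006, Thm. I.7.3] [cite: SilvermanAEC2009, Thm. X.4.14]
[cite: Miller2011LMS, §1 and Def. 1.1] -/
theorem KTPdesc.missingLowerBoundAt_of_isIsogenous_of_shaWitness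
    (hCT : exists_casselsTate_pairing (K := ℚ)) (hCassels : bsdRHS_eq_of_isIsogenous)
    (hGZK : rank_eq_analyticRank_of_analyticRank_le_one) (hmod : hasEntireLFunction_rat)
    (W₀ : WeierstrassCurve ℚ) [W₀.IsElliptic] [W₀.IsGloballyMinimal] (p : ℕ) [Fact p.Prime]
    (hr : W₀.analyticRank = 0) {s : ℚ} (hs : shaAn W₀ = (s : ℂ)) (hv : padicValRat p s ≤ 2)
    (hwit : ∃ x : W₀.sha, x ≠ 0 ∧ p • x = 0)
    (W : WeierstrassCurve ℚ) [W.IsElliptic] [W.IsGloballyMinimal] (hiso : IsIsogenous W W₀) :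
    MissingLowerBoundAt W p := by
  have hr' : W₀.analyticRank ≤ 1 := by rw [hr]; exact zero_le_one
  exact TwistComparison.missingLowerBoundAt_of_isIsogenous W₀ W p hCassels hGZK hmod hiso.symm_of_charZero hr'
    (KTPdesc.missingLowerBoundAt_of_shaWitness hCT hGZK W₀ p hr hs hv hwit)

/-! ## §3 The record SHAPES on a literal model `W₀ = ⟨a₁,…,a₆⟩` -/

/-- **RECORD SHAPE, Selmer currency, at the literal certificate member** (any prime `p`): inputs by name
Cassels–Tate (`hCT`), GZK (`hGZK`); of the literal model `⟨a₁,…,a₆⟩`: global minimality (`hmin`), an odd prime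
`ℓ ∤ Δ` with `countPoints … ℓ = n` and `p ∤ n` (`hℓ`, `hℓΔ`, `hc`, `hpn` — hence `p ∤ #E(ℚ)_tors`: a rational point
of order `p` (Cauchy, `exists_addOrderOf_eq_of_dvd_torsionOrder`) would give `p = addOrderOf T ∣ #Ẽ(𝔽_ℓ) = n`
(`addOrderOf_dvd_reductionPointCount`, Silverman VII.3.1(b); `reductionPointCount_eq_of_intModel_countPoints`));
per pair: `r_an = 0` (`hr`), `#Ш_an = s` with `ord_p s ≤ 2` (`hs`, `hv`) and `Sel^(p)(E/ℚ) ≠ ⊥` (`hSel`, the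
certificate line). Conclusion = `Supersingular.missingLowerBoundAt_of_casselsTate_of_selmerGroup_ne_bot` on the
literal model. The `p = 3` instance is `K9Desc3.missingLowerBoundAt_three_of_ainvs_of_selmerGroup_ne_bot`.
Per pair; nothing booked. [cite: SilvermanAEC2009, Thm. X.4.14 and VII.3.1(b)] [cite: Miller2011LMS, §1 and Def. 1.1] -/
theorem KTPdesc.missingLowerBoundAt_of_ainvs_of_selmerGroup_ne_bot
    (hCT : exists_casselsTate_pairing (K := ℚ)) (hGZK : rank_eq_analyticRank_of_analyticRank_le_one)
    (a1 a2 a3 a4 a6 : ℤ) (hmin : (⟨a1, a2, a3, a4, a6⟩ : WeierstrassCurve ℚ).IsGloballyMinimal)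
    (p : ℕ) [Fact p.Prime] (ℓ : ℕ) (hℓp : ℓ.Prime) (hℓ : 3 ≤ ℓ) (hℓΔ : ¬ (ℓ : ℤ) ∣ discOf [a1, a2, a3, a4, a6])
    {n : ℕ} (hc : countPoints [a1, a2, a3, a4, a6] ℓ = n) (hpn : ¬ p ∣ n)
    (hr : (⟨a1, a2, a3, a4, a6⟩ : WeierstrassCurve ℚ).analyticRank = 0)
    {s : ℚ} (hs : shaAn (⟨a1, a2, a3, a4, a6⟩ : WeierstrassCurve ℚ) = (s : ℂ)) (hv : padicValRat p s ≤ 2)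
    (hSel : (⟨a1, a2, a3, a4, a6⟩ : WeierstrassCurve ℚ).selmerGroup (p : ℤ) ≠ ⊥) :
    MissingLowerBoundAt (⟨a1, a2, a3, a4, a6⟩ : WeierstrassCurve ℚ) p := by
  have h0 : discOf [a1, a2, a3, a4, a6] ≠ 0 := fun h ↦ hℓΔ (by rw [h]; exact dvd_zero _)
  haveI := X11b.isElliptic_of_discOf_ne_zero a1 a2 a3 a4 a6 h0
  haveI := hmin
  haveI : Fact ℓ.Prime := ⟨hℓp⟩
  set W₀ : WeierstrassCurve ℚ := ⟨a1, a2, a3, a4, a6⟩ with hW₀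
  have hI : integralModelInt W₀ = ⟨a1, a2, a3, a4, a6⟩ :=
    integralModelInt_eq_of_map_eq _ (map_mk_int a1 a2 a3 a4 a6)
  have hℓ2 : ℓ ≠ 2 := by omega
  have hcount : W₀.reductionPointCount ℓ = n :=
    reductionPointCount_eq_of_intModel_countPoints hI ℓ hℓ2 hℓΔ hc
  have htors : ¬ p ∣ W₀.torsionOrder := by
    intro h
    obtain ⟨T, hT⟩ := exists_addOrderOf_eq_of_dvd_torsionOrder W₀ p h
    have hfin : IsOfFinAddOrder T :=
      addOrderOf_pos_iff.mp (by rw [hT]; exact (Fact.out : p.Prime).pos)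
    have hdvd := addOrderOf_dvd_reductionPointCount W₀ ℓ hℓ
      (not_dvd_minimalDiscriminantInt_of_intModel hI hℓΔ) hfin
    rw [hT, hcount] at hdvd
    exact hpn hdvd
  exact Supersingular.missingLowerBoundAt_of_casselsTate_of_selmerGroup_ne_bot W₀ p hCT hGZK hr htors hs hv hSel

/-- **RECORD SHAPE along the class, Selmer currency — literal certificate member** (any prime `p`): as the pair
form (`W₀ = ⟨a₁,…,a₆⟩` globally minimal, odd good `ℓ` with `p ∤ #Ẽ(𝔽_ℓ)`, `r_an = 0`, `ord_p #Ш_an(W₀) ≤ 2`,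
`Sel^(p)(W₀/ℚ) ≠ ⊥`) plus Cassels `hCassels` and modularity `hmod`: `MissingLowerBoundAt W p` at every globally
minimal `W ∼_ℚ W₀` (the binder `hiso` is the Cremona/LMFDB isogeny-class datum). Per class; nothing booked.
[cite: MilneADT2006, Thm. I.7.3] [cite: SilvermanAEC2009, Thm. X.4.14 and VII.3.1(b)] [cite: Miller2011LMS, §1 and Def. 1.1] -/
theorem KTPdesc.missingLowerBoundAt_of_isIsogenous_ainvs_of_selmerGroup_ne_bot
    (hCT : exists_casselsTate_pairing (K := ℚ)) (hCassels : bsdRHS_eq_of_isIsogenous)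
    (hGZK : rank_eq_analyticRank_of_analyticRank_le_one) (hmod : hasEntireLFunction_rat)
    (a1 a2 a3 a4 a6 : ℤ) (hmin : (⟨a1, a2, a3, a4, a6⟩ : WeierstrassCurve ℚ).IsGloballyMinimal)
    (p : ℕ) [Fact p.Prime] (ℓ : ℕ) (hℓp : ℓ.Prime) (hℓ : 3 ≤ ℓ) (hℓΔ : ¬ (ℓ : ℤ) ∣ discOf [a1, a2, a3, a4, a6])
    {n : ℕ} (hc : countPoints [a1, a2, a3, a4, a6] ℓ = n) (hpn : ¬ p ∣ n)
    (hr : (⟨a1, a2, a3, a4, a6⟩ : WeierstrassCurve ℚ).analyticRank = 0)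
    {s : ℚ} (hs : shaAn (⟨a1, a2, a3, a4, a6⟩ : WeierstrassCurve ℚ) = (s : ℂ)) (hv : padicValRat p s ≤ 2)
    (hSel : (⟨a1, a2, a3, a4, a6⟩ : WeierstrassCurve ℚ).selmerGroup (p : ℤ) ≠ ⊥)
    (W : WeierstrassCurve ℚ) [W.IsElliptic] [W.IsGloballyMinimal]
    (hiso : IsIsogenous W (⟨a1, a2, a3, a4, a6⟩ : WeierstrassCurve ℚ)) : MissingLowerBoundAt W p := by
  have h0 : discOf [a1, a2, a3, a4, a6] ≠ 0 := fun h ↦ hℓΔ (by rw [h]; exact dvd_zero _)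
  haveI := X11b.isElliptic_of_discOf_ne_zero a1 a2 a3 a4 a6 h0
  haveI := hmin
  have hr' : (⟨a1, a2, a3, a4, a6⟩ : WeierstrassCurve ℚ).analyticRank ≤ 1 := by rw [hr]; exact zero_le_one
  exact TwistComparison.missingLowerBoundAt_of_isIsogenous _ W p hCassels hGZK hmod hiso.symm_of_charZero hr'
    (KTPdesc.missingLowerBoundAt_of_ainvs_of_selmerGroup_ne_bot hCT hGZK a1 a2 a3 a4 a6 hmin p ℓ hℓp hℓ hℓΔ hc
      hpn hr hs hv hSel)

/-- **RECORD SHAPE along the class, Ш-witness currency — literal certificate member** (any prime `p`; for the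
classes meeting rational `p`-torsion): `W₀ = ⟨a₁,…,a₆⟩` globally minimal (`hmin`) with `Δ ≠ 0` (`hΔ`), `r_an = 0`
(`hr`), `#Ш_an(W₀) = s`, `ord_p s ≤ 2` (`hs`, `hv`), a nonzero `x ∈ Ш(W₀)` with `p·x = 0` (`hwit`, the certificate
line: EVIDENCE = `dim Ш(W₀)[φ] ≥ 1` for a rational `p`-isogeny `φ`, torsion accounted exactly), Cassels `hCassels`,
modularity `hmod` ⇒ `MissingLowerBoundAt W p` at every globally minimal `W ∼_ℚ W₀`. Per class; nothing booked.
[cite: MilneADT2006, Thm. I.7.3] [cite: SilvermanAEC2009, Thm. X.4.14] [cite: Miller2011LMS, §1 and Def. 1.1] -/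
theorem KTPdesc.missingLowerBoundAt_of_isIsogenous_ainvs_of_shaWitness
    (hCT : exists_casselsTate_pairing (K := ℚ)) (hCassels : bsdRHS_eq_of_isIsogenous)
    (hGZK : rank_eq_analyticRank_of_analyticRank_le_one) (hmod : hasEntireLFunction_rat)
    (a1 a2 a3 a4 a6 : ℤ) (hmin : (⟨a1, a2, a3, a4, a6⟩ : WeierstrassCurve ℚ).IsGloballyMinimal)
    (hΔ : discOf [a1, a2, a3, a4, a6] ≠ 0) (p : ℕ) [Fact p.Prime]
    (hr : (⟨a1, a2, a3, a4, a6⟩ : WeierstrassCurve ℚ).analyticRank = 0)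
    {s : ℚ} (hs : shaAn (⟨a1, a2, a3, a4, a6⟩ : WeierstrassCurve ℚ) = (s : ℂ)) (hv : padicValRat p s ≤ 2)
    (hwit : letI := X11b.isElliptic_of_discOf_ne_zero a1 a2 a3 a4 a6 hΔ
      ∃ x : (⟨a1, a2, a3, a4, a6⟩ : WeierstrassCurve ℚ).sha, x ≠ 0 ∧ p • x = 0)
    (W : WeierstrassCurve ℚ) [W.IsElliptic] [W.IsGloballyMinimal]
    (hiso : IsIsogenous W (⟨a1, a2, a3, a4, a6⟩ : WeierstrassCurve ℚ)) : MissingLowerBoundAt W p := by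
  haveI := X11b.isElliptic_of_discOf_ne_zero a1 a2 a3 a4 a6 hΔ
  haveI := hmin
  exact KTPdesc.missingLowerBoundAt_of_isIsogenous_of_shaWitness hCT hCassels hGZK hmod _ p hr hs hv hwit W hiso

/-! ## §4 The registered stub's REDUCIBLE disjunct from ONE certificate per class -/

/-- **The reducible disjunct of `Sig.stub_intr_residualNonCM` (birth skeleton v4 of 19618; conclusion and row
binders VERBATIM, `Intrinsic` inlined, restricted by `¬ Irr W p`) from the four published facts and ONE
CERTIFICATE PER CLASS.** `hwit`: every intrinsic non-CM (t′) rank-`0` row `W` at an odd `p` with `E[p]` reducible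
has, in its `ℚ`-isogeny class, a globally minimal member `W₀` of analytic rank `0` with `ord_p #Ш_an(W₀) ≤ 2`
carrying EITHER (`p ∤ #W₀(ℚ)_tors` and `Sel^(p)(W₀/ℚ) ≠ ⊥`) OR a nonzero `x ∈ Ш(W₀)` with `p·x = 0` — the per-class
certificate slot (census of this seat, kit j257757: the `p`-torsion-free member with `ord_p #Ш_an = 2` of the 14 + 3
torsion-free classes, resp. the Ш-witness at the `#Ш_an = 9` member of the 10 classes meeting rational
`3`-torsion; the 3 MIRROR classes 169812c / 263934k / 434070da — `#Ш_an = 9` only at members with a rational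
`3`-torsion point whose `Ш[φ]` vanishes, `81` at their partners — carry no first-descent certificate and are this
road's residue). The stub's own hypothesis `¬((5 ≤ p ∧ Surj W p) ∨ (p = 3 ∧ tower onto ∧ #E(ℚ₃)[3] = 1))` holds
automatically on a reducible row and is omitted. HONEST LABEL: a per-class road made uniform by hypothesis —
class-wide `hwit` is the stub's own content on the reducible rows (Kato 12.10 lower half at an additive
potentially supersingular `p`, reducible `E[p]`; open); conditional; the item is NOT closed.
[cite: Kato2004Asterisque, Conj. 12.10 (p. 224)] [cite: SilvermanAEC2009, Thm. X.4.14] [cite: MilneADT2006, Thm. I.7.3]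
[cite: Miller2011LMS, §1 and Def. 1.1] -/
theorem KTPdesc.stub_intr_residualNonCM_reducible_of_certificates
    (hCT : exists_casselsTate_pairing (K := ℚ)) (hCassels : bsdRHS_eq_of_isIsogenous)
    (hGZK : rank_eq_analyticRank_of_analyticRank_le_one) (hmod : hasEntireLFunction_rat)
    (hwit : ∀ (W : WeierstrassCurve ℚ) [W.IsElliptic] [W.IsGloballyMinimal] (p : ℕ) [Fact p.Prime],
      W.analyticRank = 0 → p ≠ 2 → Addv W p → SubTprime W p → ¬ Irr W p → ¬ W.HasCM →
      (∀ (W' : WeierstrassCurve ℚ) [W'.IsElliptic] [W'.IsGloballyMinimal], IsIsogenous W W' →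
        ∀ q' : ℚ, shaAn W' = (q' : ℂ) → 0 < padicValRat p q') →
      ∃ (W₀ : WeierstrassCurve ℚ) (_ : W₀.IsElliptic) (_ : W₀.IsGloballyMinimal),
        IsIsogenous W W₀ ∧ W₀.analyticRank = 0 ∧
        ∃ s : ℚ, shaAn W₀ = (s : ℂ) ∧ padicValRat p s ≤ 2 ∧
          ((¬ p ∣ W₀.torsionOrder ∧ W₀.selmerGroup (p : ℤ) ≠ ⊥) ∨ ∃ x : W₀.sha, x ≠ 0 ∧ p • x = 0)) :
    ∀ (W : WeierstrassCurve ℚ) [W.IsElliptic] [W.IsGloballyMinimal] (p : ℕ) [Fact p.Prime],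
      W.analyticRank = 0 → p ≠ 2 → Addv W p → SubTprime W p → ¬ Irr W p → ¬ W.HasCM →
      (∀ (W' : WeierstrassCurve ℚ) [W'.IsElliptic] [W'.IsGloballyMinimal], IsIsogenous W W' →
        ∀ q' : ℚ, shaAn W' = (q' : ℂ) → 0 < padicValRat p q') →
      MissingLowerBoundAt W p := by
  intro W _ _ p _ hr hp2 hadd hT hred hCM hI
  obtain ⟨W₀, hE₀, hM₀, hiso, hr₀, s, hs, hv, hcert⟩ := hwit W p hr hp2 hadd hT hred hCM hI
  haveI := hE₀
  haveI := hM₀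
  rcases hcert with ⟨htors, hSel⟩ | hx
  · exact KTPdesc.missingLowerBoundAt_of_isIsogenous_of_selmerGroup_ne_bot hCT hCassels hGZK hmod W₀ p hr₀ htors
      hs hv hSel W hiso
  · exact KTPdesc.missingLowerBoundAt_of_isIsogenous_of_shaWitness hCT hCassels hGZK hmod W₀ p hr₀ hs hv hx W hiso

end Summit.BirchSwinnertonDyer.BirchSwinnertonDyer.Theorems

end
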